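import Mathlib
import Summits.KontsevichZagierPeriods.KontsevichZagierPeriods.Theorems.FermatIsogenyBetaProductSectorDefs
import Summits.KontsevichZagierPeriods.KontsevichZagierPeriods.Theorems.FermatIsogenyBetaProductSectorUniformInstances

/-!
# `BetaProductSector` (stmt-KontsevichZagierPeriods-3898), line `registered` v3 — QUAD is a `UniformStep`

The quadratic move `((x,y),(x+½,y)) ~ ((2x,2y),(½,y))` is a STEP of the chain normal form of the reshaped line
(`BetaProductSectorDefs.UniformStep`): its slope data is fully uniform (`quad_isFullyUniform`, landed) and its value identity
`B(x,y)B(x+½,y) = 2·B(2x,2y)B(½,y)` holds (three Legendre duplications, `beta_quad_identity`). Together with the landed KZ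
theorem `stub_quadStep` (p162508) this is the first genuinely two-dimensional instance of the pair (COMB step, UNIF instance)
of the line. Lead c3.
-/

noncomputable section
open Real

namespace Summit.KontsevichZagierPeriods.FermatIsogeny.BetaProductSectorStubs

/-- Power bookkeeping of the three duplications: `2^{1−2x}·2^{1−2y} = 2·2^{1−2(x+y)}`. [folklore] -/
theorem two_rpow_quad (x y : ℝ) : (2:ℝ) ^ (1 - 2 * x) * (2:ℝ) ^ (1 - 2 * y) = 2 * (2:ℝ) ^ (1 - 2 * (x + y)) := by
  rw [← Real.rpow_add two_pos]
  conv_rhs => rw [show (2:ℝ) * (2:ℝ) ^ (1 - 2 * (x + y)) = (2:ℝ) ^ (1:ℝ) * (2:ℝ) ^ (1 - 2 * (x + y)) by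
    rw [Real.rpow_one], ← Real.rpow_add two_pos]
  congr 1; ring

/-- **The value identity of the quadratic move**: `B(x,y)·B(x+½,y) = 2·B(2x,2y)·B(½,y)` for `x, y > 0`
(`B = ProbabilityTheory.beta`; three Legendre duplications). [cite: AndrewsAskeyRoy1999, Thm 1.5.1] -/
theorem beta_quad_identity (x y : ℝ) (hx : 0 < x) (hy : 0 < y) :
    ProbabilityTheory.beta x y * ProbabilityTheory.beta (x + 1 / 2) y =
      2 * (ProbabilityTheory.beta (2 * x) (2 * y) * ProbabilityTheory.beta (1 / 2) y) := by
  simp only [ProbabilityTheory.beta]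
  rw [show x + 1 / 2 + y = (x + y) + 1 / 2 by ring, show 2 * x + 2 * y = 2 * (x + y) by ring,
    show (1:ℝ) / 2 + y = y + 1 / 2 by ring]
  have D1 := Real.Gamma_mul_Gamma_add_half x
  have D2 := Real.Gamma_mul_Gamma_add_half (x + y)
  have D3 := Real.Gamma_mul_Gamma_add_half y
  have Gh : Real.Gamma (1 / 2) = √π := Real.Gamma_one_half_eq
  have E := two_rpow_quad x y
  have hg : ∀ t : ℝ, 0 < t → Real.Gamma t ≠ 0 := fun t ht => (Real.Gamma_pos_of_pos ht).ne'
  have h1 := hg (x + y) (by linarith)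
  have h2 := hg ((x + y) + 1 / 2) (by linarith)
  have h3 := hg (2 * (x + y)) (by linarith)
  have h4 := hg (y + 1 / 2) (by linarith)
  rw [div_mul_div_comm, div_mul_div_comm, ← mul_div_assoc, div_eq_div_iff (mul_ne_zero h1 h2) (mul_ne_zero h3 h4)]
  linear_combination
    (Real.Gamma y * Real.Gamma y * (Real.Gamma (2 * (x + y)) * Real.Gamma (y + 1 / 2))) * D1
    - (2 * (Real.Gamma (2 * x) * Real.Gamma (2 * y) * (Real.Gamma (1 / 2) * Real.Gamma y))) * D2
    - (2 * Real.Gamma (2 * x) * Real.Gamma (2 * y) * Real.Gamma y * Real.Gamma (2 * (x + y)) *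
        (2:ℝ) ^ (1 - 2 * (x + y)) * √π) * Gh
    + (Real.Gamma (2 * x) * (2:ℝ) ^ (1 - 2 * x) * √π * Real.Gamma y * Real.Gamma (2 * (x + y))) * D3
    + (Real.Gamma (2 * x) * √π * √π * Real.Gamma y * Real.Gamma (2 * (x + y)) * Real.Gamma (2 * y)) * E

/-- **QUAD is a uniform step** of the chain normal form: for rational `x, y > 0`,
`UniformStep ((x,y),(x+½,y)) ((2x,2y),(½,y))` with the algebraic constant `2`. [cite: AndrewsAskeyRoy1999, Thm 1.5.1] -/
theorem quad_uniformStep : ∀ (x y : ℚ), 0 < x → 0 < y →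
    Summit.KontsevichZagierPeriods.FermatIsogeny.BetaProductSectorDefs.UniformStep ((x, y), (x + 1 / 2, y))
      ((2 * x, 2 * y), (1 / 2, y)) := by
  intro x y hx hy
  refine ⟨x, y, x + 1 / 2, y, 2 * x, 2 * y, 1 / 2, y, 1, 1, 1, 1, 2, 2, 0, 1, 2, hx, hy, by linarith, hy, by linarith,
    by linarith, by norm_num, hy, quad_isFullyUniform x y, ?_, ?_, rfl, rfl⟩
  · exact_mod_cast isAlgebraic_algebraMap (R := ℚ) (A := ℝ) (2 : ℚ)
  · have h := beta_quad_identity (x : ℝ) (y : ℝ) (by exact_mod_cast hx) (by exact_mod_cast hy)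
    push_cast
    exact h

end Summit.KontsevichZagierPeriods.FermatIsogeny.BetaProductSectorStubs

end
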